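import Literature.MathematicalPhysics.QuantumFieldTheory.Balaban1983to89.B9Thm37GlueLevelSumOsc
import Literature.MathematicalPhysics.QuantumFieldTheory.Balaban1983to89.B9Thm37GlueSz

/-!
# `Balaban1983to89.B9Thm37GlueTowerEntries` — the four entries of (3.42) for G′ (Theorem 3.7 of [B9] via the lineage
# `B9Thm37GlueSz`) with the AVERAGING PART OF Δ′_a THE TOWER'S MULTI-LEVEL Q′\*aQ′ = Σ_{l≤k} a_lG_lᵀG_l and its Q-binders
# DISCHARGED (abstract lattice; companion of `B9Thm37GlueTowerEntry4` = the torus entry 4; cell `pub-ymgap`, Track A node N06 [B9]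
# second -b seat dag-n19-b, dag-lead's word l.9643; count-neutral MODEL bookkeeping)

References (bib keys): [B9] = `Balaban1985BackgroundPropagators`; [4] = `Balaban1984PropagatorsII` — only NAMED, loci certified in the
headers of `B9Thm37GlueSz` ∕ `B9Thm37GlueLevelSumComm`.

THE POINT.  `B9Thm37GlueSz.thm37_entry{1,2,3,4}_of_342_lattice_of_387_sz` (Theorem 3.7 ⇒ the four entries of (3.42) for G′ from
Corollary 3.6 for the G′_□, with the ∂h∕Δh sizes in the pointwise letters θ, θ₂) carry the averaging part `Qf` of Δ′_a ABSTRACTLY with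
the binders `hQ hKQ hlocQ hrowQ`∕`hcolQ` (+ κ_Q, and `hQt` for entry 3).  HERE `Qf` IS the tower's level sum
(`B9Thm37GlueTorusCovLevels.levelSum` over `towerBlk Ks`∕`towerTr Ks Rm` of a k-fold comb tower `Ks` on the same bonds) and those
binders are THEOREMS: `B9Thm37GlueLevelSumOsc.commData_towerLevelSum_of_bondBound` (per-bond bound θ_Q of h_□, comb depths D_j,
block counts n_j, block weights |W_l| ≤ wb_l, size letters k_l, nesting of the geometry blocking over the top level, located support
of h_□) and `B9Thm37GlueTorusCovLevels.isTransposePair_levelSum` (symmetry, entry 3).  κ_Q = Σ_{l≤k} (2(Σ_{j<l}D_j)·θ_Q)·k_l.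
Every OTHER hypothesis of the lineage's theorems is carried verbatim — NOT asserted.

HONEST SCOPE.  As `B9Thm37GlueSz` + `B9Thm37GlueLevelSumComm`: component MODEL; nothing of print asserted; NOT a node discharge;
NOT continuum, NOT Clay.
-/

namespace Literature.MathematicalPhysics.QuantumFieldTheory.Balaban1983to89.B9Thm37GlueTowerEntries

open Literature.MathematicalPhysics.QuantumFieldTheory.Balaban1983to89
open Finset B6RandomWalk B6RandomWalkHom B9Thm37Sum B9Thm34Ext B9Thm37Glue B9Thm37GlueT B9Thm37GlueSt B9Thm37GlueSz
  B9Thm37GlueTorusCov B9Thm37GlueTorusCovComp B9Thm37GlueTorusCovLevels B9Thm37GlueTorusCovTower B9Thm37GlueLevelSumComm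
  B9Thm37GlueLevelSumOsc

noncomputable section

variable {g : B9.Geometry} [Fintype g.Site] [DecidableEq g.Site] {R : ℝ} {H : Prop} {St Bd Cp : Type}

/-- **THEOREM 3.7 ⇒ ENTRY 1 OF (3.42) (sup entry of G′) FOR THE TOWER'S MULTI-LEVEL Q′\*aQ′ WITH ITS Q-BINDERS DISCHARGED** =
`B9Thm37GlueSz.thm37_entry1_of_342_lattice_of_387_sz` at `Qf := Σ_{l≤k} a_lG_lᵀG_l` (`levelSum` over `towerBlk Ks`∕`towerTr Ks Rm`), the binders
`hQ hKQ hlocQ hrowQ`∕`hcolQ` (+ κ_Q ≥ 0) supplied by `B9Thm37GlueLevelSumOsc.commData_towerLevelSum_of_bondBound` with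
κ_Q := Σ_l (2(Σ_{j<l}D_j)·θ_Q)·k_l; new displayed binders `hn hD hW hkk hk hnestTop hθQ0 hθQ hS'Q` (block counts, comb depths, block
weights, size letters, nesting of the geometry blocking over the top level, the UNWEIGHTED per-bond bound of h_□, located support);
every other hypothesis verbatim from the lineage (NOT asserted). [cite: Balaban1985BackgroundPropagators, Thm 3.7 (3.87)–(3.90) pp.408–410 + (3.42) p.397 + (3.16) p.393; Balaban1984PropagatorsII, (2.40)–(2.44) p.230] -/
theorem thm37_entry1_tower [Fintype St]
    [DecidableEq St]
    [Fintype Bd]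
    [DecidableEq Bd]
    [Fintype Cp]
    [DecidableEq Cp]
    (src tgt : Bd → St)
    {Bs : ℕ → Type} [∀ j, DecidableEq (Bs j)] (Ks : ∀ j, Comb src tgt (Bs j)) (k : ℕ)
    (W : Fin (k + 1) → St → ℝ) (a : Fin (k + 1) → ℝ) (wb kk : Fin (k + 1) → ℝ) (n D : ℕ → ℕ) (θQ : ℝ)
    (c : Bd → ℝ)
    (Rm : Bd → Cp → Cp → ℝ)
    (blk : St × Cp → g.Site)
    (blkY : Bd × Cp → g.Site)
    (d Nd : ℕ)
    (δ₀ α ρ B₀ v₁ v₂ N N' : ℝ)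
    {ι : Type}
    [Fintype ι]
    (S S' : ι → Finset g.Site)
    (hs : ι → St → ℝ)
    (θ θ₂ : ι → ℝ)
    {G' : Module.End ℝ (St × Cp → ℝ)}
    (hRm : ∀ b i j, ∑ k, Rm b k i * Rm b k j = if i = j then 1 else 0)
    (hB₀ : 0 ≤ B₀)
    (hδ₀ : 0 ≤ δ₀)
    (hρ : 0 ≤ ρ)
    (hv₁ : 0 ≤ v₁)
    (hv₂ : 0 ≤ v₂)
    (hN : 0 ≤ N)
    (hN' : 0 ≤ N')
    (hαδ : 0 ≤ (1 - α) * δ₀)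
    (htri : Triangle254 (toB6 g R H))
    (hrefl : ∀ y : g.Site, g.dist y y = 0)
    (hdnn : ∀ y y' : g.Site, 0 ≤ g.dist y y')
    (hlen : ∀ y : g.Site, 0 ≤ g.len y)
    (h261 : Ineq261 d (toB6 g R H) δ₀ α)
    (h263 : Ineq263 d (toB6 g R H) δ₀ α)
    (hsmall : N' * (B₀ * Real.exp (δ₀ * ρ) * ((Nd + Nd * Fintype.card Cp : ℝ) * v₁ + (v₂ + (∑ l : Fin (k + 1), (2 * (∑ j ∈ Finset.range l, D j : ℕ) * θQ) * kk l)))) *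
      B6.c1 d δ₀ α < 1)
    (hh : ∀ i x, |hs i x| ≤ 1)
    (hS : ∀ i (p : St × Cp), hs i p.1 ≠ 0 → blk p ∈ S i)
    (hcnt : ∀ a : g.Site, (∑ i, if a ∈ S i then (1 : ℝ) else 0) ≤ N)
    (hcnt' : ∀ a : g.Site, (∑ i, if a ∈ S' i then (1 : ℝ) else 0) ≤ N')
    (hθ0 : ∀ i, 0 ≤ θ i)
    (hθ : ∀ i b, |c b * (hs i (tgt b) - hs i (src b))| ≤ θ i)
    (hθ₂0 : ∀ i, 0 ≤ θ₂ i)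
    (hθ₂ : ∀ i x, |slap src tgt c (hs i) x| ≤ θ₂ i)
    (hsupp : ∀ i b, hs i (tgt b) ≠ hs i (src b) →
      (∀ j, blk (src b, j) ∈ S' i ∧ blk (tgt b, j) ∈ S' i) ∧ ∀ k, blkY (b, k) ∈ S' i)
    (hNs : ∀ x : St, (Finset.univ.filter (fun b => src b = x)).card ≤ Nd)
    (hNt : ∀ x : St, (Finset.univ.filter (fun b => tgt b = x)).card ≤ Nd)
    (hadj : ∀ b i k, g.dist (blk (src b, i)) (blkY (b, k)) ≤ ρ ∧ g.dist (blk (tgt b, i)) (blkY (b, k)) ≤ ρ ∧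
      g.dist (blkY (b, k)) (blk (src b, i)) ≤ ρ ∧ g.dist (blkY (b, k)) (blk (tgt b, i)) ≤ ρ)
    (hV₁ : ∀ i (a : g.Site), a ∈ S' i → θ i * ∑ y ∈ (S' i).filter (fun y => g.dist a y ≤ ρ), g.len y ≤ v₁)
    (hV₂ : ∀ i (a : g.Site), a ∈ S' i → θ₂ i * g.len a ^ 2 ≤ v₂)
    (hsq : ∀ x : St, ∑ i, hs i x ^ 2 = 1)
    (hn : ∀ j β, (Finset.univ.filter fun x => (Ks j).blk x = β).card ≤ n j) (hD : ∀ j y, (Ks j).depth y ≤ D j)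
    (hW : ∀ l x, |W l x| ≤ wb l) (hkk : ∀ l, 0 ≤ kk l)
    (hk : ∀ l (b : g.Site), |a l| * (wb l ^ 2 * (Fintype.card Cp : ℝ) ^ 2 * towerN n l) * g.len b ^ 2 ≤ kk l)
    (hnestTop : ∀ p q : St × Cp, towerBlk Ks k q.1 = towerBlk Ks k p.1 → blk q = blk p)
    (hθQ0 : 0 ≤ θQ) (hθQ : ∀ i b, |hs i (tgt b) - hs i (src b)| ≤ θQ)
    (hS'Q : ∀ i (p : St × Cp), hs i p.1 ≠ 0 → blk p ∈ S' i)
    {Gsq : ι → Module.End ℝ (St × Cp → ℝ)}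
    (h342_1 : ∀ i, HasMajorant (g := toB6 g R H) blk (Gsq i)
      (fun a b => B₀ * g.len a ^ 2 * Real.exp (-(δ₀ * g.dist a b))))
    (h342_2 : ∀ i, HasMajorantHom (g := toB6 g R H) blk blkY (covD src tgt c Rm ∘ₗ Gsq i)
      (fun a b => B₀ * g.len a * Real.exp (-(δ₀ * g.dist a b))))
    (hloc : ∀ i, mulOp (hs i ∘ Prod.fst) * (covDT src tgt c Rm ∘ₗ covD src tgt c Rm + (levelSum (fun l : Fin (k + 1) => towerBlk Ks (l : ℕ)) W (fun l => towerTr Ks Rm (l : ℕ)) a)) * Gsq i *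
      mulOp (hs i ∘ Prod.fst) = mulOp (hs i ∘ Prod.fst) * mulOp (hs i ∘ Prod.fst))
    (hinv : G' * (covDT src tgt c Rm ∘ₗ covD src tgt c Rm + (levelSum (fun l : Fin (k + 1) => towerBlk Ks (l : ℕ)) W (fun l => towerTr Ks Rm (l : ℕ)) a)) = 1) :
    HasMajorant (g := toB6 g R H) blk G'
      (fun (a b : g.Site) => N * B₀ * B6.c1 d δ₀ α *
        (1 - N' * (B₀ * Real.exp (δ₀ * ρ) * ((Nd + Nd * Fintype.card Cp : ℝ) * v₁ + (v₂ + (∑ l : Fin (k + 1), (2 * (∑ j ∈ Finset.range l, D j : ℕ) * θQ) * kk l)))) *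
          B6.c1 d δ₀ α)⁻¹ * g.len a ^ 2 *
        Real.exp (-((1 - α) * δ₀ * g.dist a b))) := by
  have hzero : ∀ i (p : St × Cp), blk p ∉ S' i → hs i p.1 = 0 := fun i p hp => by
    by_contra hne
    exact hp (hS'Q i p hne)
  obtain ⟨hQ, hKQ, hlocQ, hrowQ, hcolQ⟩ := commData_towerLevelSum_of_bondBound (g := g) (R := R) (H := H) Ks Rm hRm k W a
    wb n D blk hnestTop hW hn hD ρ (fun b => by rw [hrefl b]; exact hρ) kk hk hs S' hθQ0 hθQ hzero
  have hκQ : 0 ≤ (∑ l : Fin (k + 1), (2 * (∑ j ∈ Finset.range l, D j : ℕ) * θQ) * kk l) :=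
    Finset.sum_nonneg fun l _ => mul_nonneg (by positivity) (hkk l)
  clear hcolQ
  exact thm37_entry1_of_342_lattice_of_387_sz src tgt c Rm _ blk blkY d Nd δ₀ α ρ B₀ v₁ v₂ _ N N' S S' hs θ θ₂ _ hRm hB₀ hδ₀ hρ hv₁ hv₂ hκQ hN hN' hαδ htri hrefl hdnn hlen h261 h263 hsmall hh hS hcnt hcnt' hθ0 hθ hθ₂0 hθ₂ hsupp hNs hNt hadj hV₁ hV₂ hKQ hlocQ hrowQ hsq h342_1 h342_2 hQ hloc hinv

/-- **THEOREM 3.7 ⇒ ENTRY 2 OF (3.42) (∇G′) FOR THE TOWER'S MULTI-LEVEL Q′\*aQ′ WITH ITS Q-BINDERS DISCHARGED** =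
`B9Thm37GlueSz.thm37_entry2_of_342_lattice_of_387_sz` at `Qf := Σ_{l≤k} a_lG_lᵀG_l` (`levelSum` over `towerBlk Ks`∕`towerTr Ks Rm`), the binders
`hQ hKQ hlocQ hrowQ`∕`hcolQ` (+ κ_Q ≥ 0) supplied by `B9Thm37GlueLevelSumOsc.commData_towerLevelSum_of_bondBound` with
κ_Q := Σ_l (2(Σ_{j<l}D_j)·θ_Q)·k_l; new displayed binders `hn hD hW hkk hk hnestTop hθQ0 hθQ hS'Q` (block counts, comb depths, block
weights, size letters, nesting of the geometry blocking over the top level, the UNWEIGHTED per-bond bound of h_□, located support);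
every other hypothesis verbatim from the lineage (NOT asserted). [cite: Balaban1985BackgroundPropagators, Thm 3.7 (3.87)–(3.90) pp.408–410 + (3.42) p.397 + (3.16) p.393; Balaban1984PropagatorsII, (2.40)–(2.44) p.230] -/
theorem thm37_entry2_tower [Fintype St]
    [DecidableEq St]
    [Fintype Bd]
    [DecidableEq Bd]
    [Fintype Cp]
    [DecidableEq Cp]
    (src tgt : Bd → St)
    {Bs : ℕ → Type} [∀ j, DecidableEq (Bs j)] (Ks : ∀ j, Comb src tgt (Bs j)) (k : ℕ)
    (W : Fin (k + 1) → St → ℝ) (a : Fin (k + 1) → ℝ) (wb kk : Fin (k + 1) → ℝ) (n D : ℕ → ℕ) (θQ : ℝ)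
    (c : Bd → ℝ)
    (Rm : Bd → Cp → Cp → ℝ)
    (blk : St × Cp → g.Site)
    (blkY : Bd × Cp → g.Site)
    (d Nd : ℕ)
    (δ₀ α ρ B₀ v₁ v₂ κ₄ N N' : ℝ)
    {ι : Type}
    [Fintype ι]
    (S S' : ι → Finset g.Site)
    (hs : ι → St → ℝ)
    (θ θ₂ : ι → ℝ)
    {G' : Module.End ℝ (St × Cp → ℝ)}
    (hRm : ∀ b i j, ∑ k, Rm b k i * Rm b k j = if i = j then 1 else 0)
    (hB₀ : 0 ≤ B₀)
    (hδ₀ : 0 ≤ δ₀)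
    (hρ : 0 ≤ ρ)
    (hv₁ : 0 ≤ v₁)
    (hv₂ : 0 ≤ v₂)
    (hκ₄ : 0 ≤ κ₄)
    (hN : 0 ≤ N)
    (hN' : 0 ≤ N')
    (hαδ : 0 ≤ (1 - α) * δ₀)
    (htri : Triangle254 (toB6 g R H))
    (hrefl : ∀ y : g.Site, g.dist y y = 0)
    (hdnn : ∀ y y' : g.Site, 0 ≤ g.dist y y')
    (hlen : ∀ y : g.Site, 0 ≤ g.len y)
    (h261 : Ineq261 d (toB6 g R H) δ₀ α)
    (h263 : Ineq263 d (toB6 g R H) δ₀ α)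
    (hsmall : N' * (B₀ * Real.exp (δ₀ * ρ) * ((Nd + Nd * Fintype.card Cp : ℝ) * v₁ + (v₂ + (∑ l : Fin (k + 1), (2 * (∑ j ∈ Finset.range l, D j : ℕ) * θQ) * kk l)))) *
      B6.c1 d δ₀ α < 1)
    (hh : ∀ i x, |hs i x| ≤ 1)
    (hSY : ∀ i (v : Bd × Cp), hs i (tgt v.1) ≠ 0 → blkY v ∈ S i)
    (hcnt : ∀ a : g.Site, (∑ i, if a ∈ S i then (1 : ℝ) else 0) ≤ N)
    (hcnt' : ∀ a : g.Site, (∑ i, if a ∈ S' i then (1 : ℝ) else 0) ≤ N')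
    (hθ0 : ∀ i, 0 ≤ θ i)
    (hθ : ∀ i b, |c b * (hs i (tgt b) - hs i (src b))| ≤ θ i)
    (hθ₂0 : ∀ i, 0 ≤ θ₂ i)
    (hθ₂ : ∀ i x, |slap src tgt c (hs i) x| ≤ θ₂ i)
    (hsupp : ∀ i b, hs i (tgt b) ≠ hs i (src b) →
      (∀ j, blk (src b, j) ∈ S' i ∧ blk (tgt b, j) ∈ S' i) ∧ ∀ k, blkY (b, k) ∈ S' i)
    (hNs : ∀ x : St, (Finset.univ.filter (fun b => src b = x)).card ≤ Nd)
    (hNt : ∀ x : St, (Finset.univ.filter (fun b => tgt b = x)).card ≤ Nd)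
    (hadj : ∀ b i k, g.dist (blk (src b, i)) (blkY (b, k)) ≤ ρ ∧ g.dist (blk (tgt b, i)) (blkY (b, k)) ≤ ρ ∧
      g.dist (blkY (b, k)) (blk (src b, i)) ≤ ρ ∧ g.dist (blkY (b, k)) (blk (tgt b, i)) ≤ ρ)
    (hV₁ : ∀ i (a : g.Site), a ∈ S' i → θ i * ∑ y ∈ (S' i).filter (fun y => g.dist a y ≤ ρ), g.len y ≤ v₁)
    (hV₂ : ∀ i (a : g.Site), a ∈ S' i → θ₂ i * g.len a ^ 2 ≤ v₂)
    (hV₃ : ∀ i (a : g.Site), a ∈ S' i →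
      θ i * ∑ y ∈ (S' i).filter (fun y => g.dist a y ≤ ρ), g.len y ^ 2 ≤ κ₄ * g.len a)
    (hsq : ∀ x : St, ∑ i, hs i x ^ 2 = 1)
    (hn : ∀ j β, (Finset.univ.filter fun x => (Ks j).blk x = β).card ≤ n j) (hD : ∀ j y, (Ks j).depth y ≤ D j)
    (hW : ∀ l x, |W l x| ≤ wb l) (hkk : ∀ l, 0 ≤ kk l)
    (hk : ∀ l (b : g.Site), |a l| * (wb l ^ 2 * (Fintype.card Cp : ℝ) ^ 2 * towerN n l) * g.len b ^ 2 ≤ kk l)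
    (hnestTop : ∀ p q : St × Cp, towerBlk Ks k q.1 = towerBlk Ks k p.1 → blk q = blk p)
    (hθQ0 : 0 ≤ θQ) (hθQ : ∀ i b, |hs i (tgt b) - hs i (src b)| ≤ θQ)
    (hS'Q : ∀ i (p : St × Cp), hs i p.1 ≠ 0 → blk p ∈ S' i)
    {Gsq : ι → Module.End ℝ (St × Cp → ℝ)}
    (h342_1 : ∀ i, HasMajorant (g := toB6 g R H) blk (Gsq i)
      (fun a b => B₀ * g.len a ^ 2 * Real.exp (-(δ₀ * g.dist a b))))
    (h342_2 : ∀ i, HasMajorantHom (g := toB6 g R H) blk blkY (covD src tgt c Rm ∘ₗ Gsq i)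
      (fun a b => B₀ * g.len a * Real.exp (-(δ₀ * g.dist a b))))
    (hloc : ∀ i, mulOp (hs i ∘ Prod.fst) * (covDT src tgt c Rm ∘ₗ covD src tgt c Rm + (levelSum (fun l : Fin (k + 1) => towerBlk Ks (l : ℕ)) W (fun l => towerTr Ks Rm (l : ℕ)) a)) * Gsq i *
      mulOp (hs i ∘ Prod.fst) = mulOp (hs i ∘ Prod.fst) * mulOp (hs i ∘ Prod.fst))
    (hinv : G' * (covDT src tgt c Rm ∘ₗ covD src tgt c Rm + (levelSum (fun l : Fin (k + 1) => towerBlk Ks (l : ℕ)) W (fun l => towerTr Ks Rm (l : ℕ)) a)) = 1) :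
    HasMajorantHom (g := toB6 g R H) blk blkY (covD src tgt c Rm ∘ₗ G')
      (fun (a b : g.Site) => B₀ * (N + N' * Real.exp (δ₀ * ρ) * κ₄) * B6.c1 d δ₀ α *
        (1 - N' * (B₀ * Real.exp (δ₀ * ρ) * ((Nd + Nd * Fintype.card Cp : ℝ) * v₁ + (v₂ + (∑ l : Fin (k + 1), (2 * (∑ j ∈ Finset.range l, D j : ℕ) * θQ) * kk l)))) *
          B6.c1 d δ₀ α)⁻¹ * g.len a *
        Real.exp (-((1 - α) * δ₀ * g.dist a b))) := by
  have hzero : ∀ i (p : St × Cp), blk p ∉ S' i → hs i p.1 = 0 := fun i p hp => by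
    by_contra hne
    exact hp (hS'Q i p hne)
  obtain ⟨hQ, hKQ, hlocQ, hrowQ, hcolQ⟩ := commData_towerLevelSum_of_bondBound (g := g) (R := R) (H := H) Ks Rm hRm k W a
    wb n D blk hnestTop hW hn hD ρ (fun b => by rw [hrefl b]; exact hρ) kk hk hs S' hθQ0 hθQ hzero
  have hκQ : 0 ≤ (∑ l : Fin (k + 1), (2 * (∑ j ∈ Finset.range l, D j : ℕ) * θQ) * kk l) :=
    Finset.sum_nonneg fun l _ => mul_nonneg (by positivity) (hkk l)
  clear hcolQ
  exact thm37_entry2_of_342_lattice_of_387_sz src tgt c Rm _ blk blkY d Nd δ₀ α ρ B₀ v₁ v₂ _ κ₄ N N' S S' hs θ θ₂ _ hRm hB₀ hδ₀ hρ hv₁ hv₂ hκQ hκ₄ hN hN' hαδ htri hrefl hdnn hlen h261 h263 hsmall hh hSY hcnt hcnt' hθ0 hθ hθ₂0 hθ₂ hsupp hNs hNt hadj hV₁ hV₂ hV₃ hKQ hlocQ hrowQ hsq h342_1 h342_2 hQ hloc hinv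

/-- **THEOREM 3.7 ⇒ ENTRY 3 OF (3.42) (G′∇*, via the transpose; `hQt` discharged by `isTransposePair_levelSum`) FOR THE TOWER'S MULTI-LEVEL Q′\*aQ′ WITH ITS Q-BINDERS DISCHARGED** =
`B9Thm37GlueSz.thm37_entry3_of_342_lattice_of_387_sz` at `Qf := Σ_{l≤k} a_lG_lᵀG_l` (`levelSum` over `towerBlk Ks`∕`towerTr Ks Rm`), the binders
`hQ hKQ hlocQ hrowQ`∕`hcolQ` (+ κ_Q ≥ 0) supplied by `B9Thm37GlueLevelSumOsc.commData_towerLevelSum_of_bondBound` with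
κ_Q := Σ_l (2(Σ_{j<l}D_j)·θ_Q)·k_l; new displayed binders `hn hD hW hkk hk hnestTop hθQ0 hθQ hS'Q` (block counts, comb depths, block
weights, size letters, nesting of the geometry blocking over the top level, the UNWEIGHTED per-bond bound of h_□, located support);
every other hypothesis verbatim from the lineage (NOT asserted). [cite: Balaban1985BackgroundPropagators, Thm 3.7 (3.87)–(3.90) pp.408–410 + (3.42) p.397 + (3.16) p.393; Balaban1984PropagatorsII, (2.40)–(2.44) p.230] -/
theorem thm37_entry3_tower [Fintype St]
    [DecidableEq St]
    [Fintype Cp]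
    [DecidableEq Cp]
    [Fintype Bd]
    [DecidableEq Bd]
    (blk : St × Cp → g.Site)
    (blkY : Bd × Cp → g.Site)
    (src tgt : Bd → St)
    {Bs : ℕ → Type} [∀ j, DecidableEq (Bs j)] (Ks : ∀ j, Comb src tgt (Bs j)) (k : ℕ)
    (W : Fin (k + 1) → St → ℝ) (a : Fin (k + 1) → ℝ) (wb kk : Fin (k + 1) → ℝ) (n D : ℕ → ℕ) (θQ : ℝ)
    (c : Bd → ℝ)
    (Rm : Bd → Cp → Cp → ℝ)
    (d Nd : ℕ)
    (δ₀ α ρ B₀ w₁ v₂ Cℓ N N' : ℝ)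
    {ι : Type}
    [Fintype ι]
    (S S' : ι → Finset g.Site)
    (hs : ι → St → ℝ)
    (θ θ₂ : ι → ℝ)
    {G' : Module.End ℝ (St × Cp → ℝ)}
    (hRm : ∀ b i j, ∑ k, Rm b k i * Rm b k j = if i = j then 1 else 0)
    (hB₀ : 0 ≤ B₀)
    (hδ₀ : 0 ≤ δ₀)
    (hρ : 0 ≤ ρ)
    (hw₁ : 0 ≤ w₁)
    (hv₂ : 0 ≤ v₂)
    (hCℓ : 0 ≤ Cℓ)
    (hN : 0 ≤ N)
    (hN' : 0 ≤ N')
    (hαδ : 0 ≤ α * δ₀)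
    (hαδ2 : 0 ≤ (1 - 2 * α) * δ₀)
    (htri : Triangle254 (toB6 g R H))
    (hrefl : ∀ y : g.Site, g.dist y y = 0)
    (hsym : ∀ y y' : g.Site, g.dist y y' = g.dist y' y)
    (hdnn : ∀ y y' : g.Site, 0 ≤ g.dist y y')
    (hlenpos : ∀ y : g.Site, 0 < g.len y)
    (h261 : Ineq261 d (toB6 g R H) δ₀ α)
    (h263 : Ineq263 d (toB6 g R H) δ₀ α)
    (hsmall : N' * (B₀ * Real.exp (δ₀ * ρ) * ((1 + Fintype.card Cp : ℝ) * w₁ + Cℓ * (v₂ + (∑ l : Fin (k + 1), (2 * (∑ j ∈ Finset.range l, D j : ℕ) * θQ) * kk l)))) *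
      B6.c1 d δ₀ α < 1)
    (hh : ∀ i x, |hs i x| ≤ 1)
    (hS : ∀ i (p : St × Cp), hs i p.1 ≠ 0 → blk p ∈ S i)
    (hcnt : ∀ a : g.Site, (∑ i, if a ∈ S i then (1 : ℝ) else 0) ≤ N)
    (hcnt' : ∀ b : g.Site, (∑ i, if b ∈ S' i then (1 : ℝ) else 0) ≤ N')
    (hcomp : ∀ i (a b : g.Site), a ∈ S i → b ∈ S' i → g.len a ≤ Cℓ * g.len b)
    (hθ0 : ∀ i, 0 ≤ θ i)
    (hθ : ∀ i b, |c b * (hs i (tgt b) - hs i (src b))| ≤ θ i)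
    (hθ₂0 : ∀ i, 0 ≤ θ₂ i)
    (hθ₂ : ∀ i x, |slap src tgt c (hs i) x| ≤ θ₂ i)
    (hsupp : ∀ i b, hs i (tgt b) ≠ hs i (src b) →
      (∀ j, blk (src b, j) ∈ S' i ∧ blk (tgt b, j) ∈ S' i) ∧ ∀ k, blkY (b, k) ∈ S' i)
    (hNs : ∀ x : St, (Finset.univ.filter (fun b => src b = x)).card ≤ Nd)
    (hadj : ∀ b i k, g.dist (blk (src b, i)) (blkY (b, k)) ≤ ρ ∧ g.dist (blk (tgt b, i)) (blkY (b, k)) ≤ ρ ∧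
      g.dist (blkY (b, k)) (blk (src b, i)) ≤ ρ ∧ g.dist (blkY (b, k)) (blk (tgt b, i)) ≤ ρ)
    (hC₁ : ∀ i (b : g.Site), b ∈ S' i →
      θ i * ((S' i).filter (fun y => g.dist y b ≤ ρ)).card * g.len b ≤ w₁)
    (hV₂ : ∀ i (a : g.Site), a ∈ S' i → θ₂ i * g.len a ^ 2 ≤ v₂)
    (hsq : ∀ x : St, ∑ i, hs i x ^ 2 = 1)
    (hn : ∀ j β, (Finset.univ.filter fun x => (Ks j).blk x = β).card ≤ n j) (hD : ∀ j y, (Ks j).depth y ≤ D j)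
    (hW : ∀ l x, |W l x| ≤ wb l) (hkk : ∀ l, 0 ≤ kk l)
    (hk : ∀ l (b : g.Site), |a l| * (wb l ^ 2 * (Fintype.card Cp : ℝ) ^ 2 * towerN n l) * g.len b ^ 2 ≤ kk l)
    (hnestTop : ∀ p q : St × Cp, towerBlk Ks k q.1 = towerBlk Ks k p.1 → blk q = blk p)
    (hθQ0 : 0 ≤ θQ) (hθQ : ∀ i b, |hs i (tgt b) - hs i (src b)| ≤ θQ)
    (hS'Q : ∀ i (p : St × Cp), hs i p.1 ≠ 0 → blk p ∈ S' i)
    {Gsq : ι → Module.End ℝ (St × Cp → ℝ)}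
    (h342_1 : ∀ i, HasMajorant (g := toB6 g R H) blk (Gsq i)
      (fun a b => B₀ * g.len a ^ 2 * Real.exp (-(δ₀ * g.dist a b))))
    (h342_3 : ∀ i, HasMajorantHom (g := toB6 g R H) blkY blk (Gsq i ∘ₗ covDT src tgt c Rm)
      (fun a b => B₀ * g.len a * Real.exp (-(δ₀ * g.dist a b))))
    (hG : ∀ i, IsTransposePair (Gsq i) (Gsq i))
    (hloc : ∀ i, mulOp (hs i ∘ Prod.fst) * (covDT src tgt c Rm ∘ₗ covD src tgt c Rm + (levelSum (fun l : Fin (k + 1) => towerBlk Ks (l : ℕ)) W (fun l => towerTr Ks Rm (l : ℕ)) a)) * Gsq i *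
      mulOp (hs i ∘ Prod.fst) = mulOp (hs i ∘ Prod.fst) * mulOp (hs i ∘ Prod.fst))
    (hinv : G' * (covDT src tgt c Rm ∘ₗ covD src tgt c Rm + (levelSum (fun l : Fin (k + 1) => towerBlk Ks (l : ℕ)) W (fun l => towerTr Ks Rm (l : ℕ)) a)) = 1) :
    HasMajorantHom (g := toB6 g R H) blkY blk (G' ∘ₗ covDT src tgt c Rm)
      (fun (a b : g.Site) => B₀ * (N + N' * Real.exp (δ₀ * ρ) * Cℓ * (Nd * w₁)) * B6.c1 d δ₀ α *
        (1 - N' * (B₀ * Real.exp (δ₀ * ρ) * ((1 + Fintype.card Cp : ℝ) * w₁ + Cℓ * (v₂ + (∑ l : Fin (k + 1), (2 * (∑ j ∈ Finset.range l, D j : ℕ) * θQ) * kk l)))) *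
          B6.c1 d δ₀ α)⁻¹ * g.len a *
        Real.exp (-((1 - 2 * α) * δ₀ * g.dist a b))) := by
  have hzero : ∀ i (p : St × Cp), blk p ∉ S' i → hs i p.1 = 0 := fun i p hp => by
    by_contra hne
    exact hp (hS'Q i p hne)
  obtain ⟨hQ, hKQ, hlocQ, hrowQ, hcolQ⟩ := commData_towerLevelSum_of_bondBound (g := g) (R := R) (H := H) Ks Rm hRm k W a
    wb n D blk hnestTop hW hn hD ρ (fun b => by rw [hrefl b]; exact hρ) kk hk hs S' hθQ0 hθQ hzero
  have hκQ : 0 ≤ (∑ l : Fin (k + 1), (2 * (∑ j ∈ Finset.range l, D j : ℕ) * θQ) * kk l) :=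
    Finset.sum_nonneg fun l _ => mul_nonneg (by positivity) (hkk l)
  clear hrowQ
  exact thm37_entry3_of_342_lattice_of_387_sz blk blkY src tgt c Rm _ d Nd δ₀ α ρ B₀ w₁ v₂ _ Cℓ N N' S S' hs θ θ₂ _ hRm hB₀ hδ₀ hρ hw₁ hv₂ hκQ hCℓ hN hN' hαδ hαδ2 htri hrefl hsym hdnn hlenpos h261 h263 hsmall hh hS hcnt hcnt' hcomp hθ0 hθ hθ₂0 hθ₂ hsupp hNs hadj hC₁ hV₂ hKQ hlocQ hcolQ hsq h342_1 h342_3 hQ (isTransposePair_levelSum _ _ _ _) hG hloc hinv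

/-- **THEOREM 3.7 ⇒ ENTRY 4 OF (3.42) (ΔG′) FOR THE TOWER'S MULTI-LEVEL Q′\*aQ′ WITH ITS Q-BINDERS DISCHARGED** =
`B9Thm37GlueSz.thm37_entry4_of_342_lattice_of_387_sz` at `Qf := Σ_{l≤k} a_lG_lᵀG_l` (`levelSum` over `towerBlk Ks`∕`towerTr Ks Rm`), the binders
`hQ hKQ hlocQ hrowQ`∕`hcolQ` (+ κ_Q ≥ 0) supplied by `B9Thm37GlueLevelSumOsc.commData_towerLevelSum_of_bondBound` with
κ_Q := Σ_l (2(Σ_{j<l}D_j)·θ_Q)·k_l; new displayed binders `hn hD hW hkk hk hnestTop hθQ0 hθQ hS'Q` (block counts, comb depths, block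
weights, size letters, nesting of the geometry blocking over the top level, the UNWEIGHTED per-bond bound of h_□, located support);
every other hypothesis verbatim from the lineage (NOT asserted). [cite: Balaban1985BackgroundPropagators, Thm 3.7 (3.87)–(3.90) pp.408–410 + (3.42) p.397 + (3.16) p.393; Balaban1984PropagatorsII, (2.40)–(2.44) p.230] -/
theorem thm37_entry4_tower [Fintype St]
    [DecidableEq St]
    [Fintype Cp]
    [DecidableEq Cp]
    [Fintype Bd]
    (blk : St × Cp → g.Site)
    (blkY : Bd × Cp → g.Site)
    (src tgt : Bd → St)
    {Bs : ℕ → Type} [∀ j, DecidableEq (Bs j)] (Ks : ∀ j, Comb src tgt (Bs j)) (k : ℕ)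
    (W : Fin (k + 1) → St → ℝ) (a : Fin (k + 1) → ℝ) (wb kk : Fin (k + 1) → ℝ) (n D : ℕ → ℕ) (θQ : ℝ)
    (c : Bd → ℝ)
    (Rm : Bd → Cp → Cp → ℝ)
    (d Nd : ℕ)
    (δ₀ α ρ B₀ v₁ v₂ N N' : ℝ)
    {ι : Type}
    [Fintype ι]
    (S S' : ι → Finset g.Site)
    (hs : ι → St → ℝ)
    (θ θ₂ : ι → ℝ)
    {G' : Module.End ℝ (St × Cp → ℝ)}
    (hRm : ∀ b i j, ∑ k, Rm b k i * Rm b k j = if i = j then 1 else 0)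
    (hB₀ : 0 ≤ B₀)
    (hδ₀ : 0 ≤ δ₀)
    (hρ : 0 ≤ ρ)
    (hv₁ : 0 ≤ v₁)
    (hv₂ : 0 ≤ v₂)
    (hN : 0 ≤ N)
    (hN' : 0 ≤ N')
    (hαδ : 0 ≤ (1 - α) * δ₀)
    (htri : Triangle254 (toB6 g R H))
    (hrefl : ∀ y : g.Site, g.dist y y = 0)
    (hdnn : ∀ y y' : g.Site, 0 ≤ g.dist y y')
    (hlen : ∀ y : g.Site, 0 ≤ g.len y)
    (h261 : Ineq261 d (toB6 g R H) δ₀ α)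
    (h263 : Ineq263 d (toB6 g R H) δ₀ α)
    (hsmall : N' * (B₀ * Real.exp (δ₀ * ρ) * ((Nd + Nd * Fintype.card Cp : ℝ) * v₁ + (v₂ + (∑ l : Fin (k + 1), (2 * (∑ j ∈ Finset.range l, D j : ℕ) * θQ) * kk l)))) *
      B6.c1 d δ₀ α < 1)
    (hh : ∀ i x, |hs i x| ≤ 1)
    (hS : ∀ i (p : St × Cp), hs i p.1 ≠ 0 → blk p ∈ S i)
    (hcnt : ∀ a : g.Site, (∑ i, if a ∈ S i then (1 : ℝ) else 0) ≤ N)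
    (hcnt' : ∀ a : g.Site, (∑ i, if a ∈ S' i then (1 : ℝ) else 0) ≤ N')
    (hθ0 : ∀ i, 0 ≤ θ i)
    (hθ : ∀ i b, |c b * (hs i (tgt b) - hs i (src b))| ≤ θ i)
    (hθ₂0 : ∀ i, 0 ≤ θ₂ i)
    (hθ₂ : ∀ i x, |slap src tgt c (hs i) x| ≤ θ₂ i)
    (hsupp : ∀ i b, hs i (tgt b) ≠ hs i (src b) →
      (∀ j, blk (src b, j) ∈ S' i ∧ blk (tgt b, j) ∈ S' i) ∧ ∀ k, blkY (b, k) ∈ S' i)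
    (hNs : ∀ x : St, (Finset.univ.filter (fun b => src b = x)).card ≤ Nd)
    (hNt : ∀ x : St, (Finset.univ.filter (fun b => tgt b = x)).card ≤ Nd)
    (hadj : ∀ b i k, g.dist (blk (src b, i)) (blkY (b, k)) ≤ ρ ∧ g.dist (blk (tgt b, i)) (blkY (b, k)) ≤ ρ ∧
      g.dist (blkY (b, k)) (blk (src b, i)) ≤ ρ ∧ g.dist (blkY (b, k)) (blk (tgt b, i)) ≤ ρ)
    (hV₁ : ∀ i (a : g.Site), a ∈ S' i → θ i * ∑ y ∈ (S' i).filter (fun y => g.dist a y ≤ ρ), g.len y ≤ v₁)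
    (hV₂ : ∀ i (a : g.Site), a ∈ S' i → θ₂ i * g.len a ^ 2 ≤ v₂)
    (hsq : ∀ x : St, ∑ i, hs i x ^ 2 = 1)
    (hn : ∀ j β, (Finset.univ.filter fun x => (Ks j).blk x = β).card ≤ n j) (hD : ∀ j y, (Ks j).depth y ≤ D j)
    (hW : ∀ l x, |W l x| ≤ wb l) (hkk : ∀ l, 0 ≤ kk l)
    (hk : ∀ l (b : g.Site), |a l| * (wb l ^ 2 * (Fintype.card Cp : ℝ) ^ 2 * towerN n l) * g.len b ^ 2 ≤ kk l)
    (hnestTop : ∀ p q : St × Cp, towerBlk Ks k q.1 = towerBlk Ks k p.1 → blk q = blk p)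
    (hθQ0 : 0 ≤ θQ) (hθQ : ∀ i b, |hs i (tgt b) - hs i (src b)| ≤ θQ)
    (hS'Q : ∀ i (p : St × Cp), hs i p.1 ≠ 0 → blk p ∈ S' i)
    {Gsq : ι → Module.End ℝ (St × Cp → ℝ)}
    (h342_1 : ∀ i, HasMajorant (g := toB6 g R H) blk (Gsq i)
      (fun a b => B₀ * g.len a ^ 2 * Real.exp (-(δ₀ * g.dist a b))))
    (h342_2 : ∀ i, HasMajorantHom (g := toB6 g R H) blk blkY (covD src tgt c Rm ∘ₗ Gsq i)
      (fun a b => B₀ * g.len a * Real.exp (-(δ₀ * g.dist a b))))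
    (h342_4 : ∀ i, HasMajorantHom (g := toB6 g R H) blk blk ((covDT src tgt c Rm ∘ₗ covD src tgt c Rm) ∘ₗ Gsq i)
      (fun a b => B₀ * Real.exp (-(δ₀ * g.dist a b))))
    (hloc : ∀ i, mulOp (hs i ∘ Prod.fst) * (covDT src tgt c Rm ∘ₗ covD src tgt c Rm + (levelSum (fun l : Fin (k + 1) => towerBlk Ks (l : ℕ)) W (fun l => towerTr Ks Rm (l : ℕ)) a)) * Gsq i *
      mulOp (hs i ∘ Prod.fst) = mulOp (hs i ∘ Prod.fst) * mulOp (hs i ∘ Prod.fst))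
    (hinv : G' * (covDT src tgt c Rm ∘ₗ covD src tgt c Rm + (levelSum (fun l : Fin (k + 1) => towerBlk Ks (l : ℕ)) W (fun l => towerTr Ks Rm (l : ℕ)) a)) = 1) :
    HasMajorantHom (g := toB6 g R H) blk blk ((covDT src tgt c Rm ∘ₗ covD src tgt c Rm) ∘ₗ G')
      (fun (a b : g.Site) => B₀ * (N + N' * Real.exp (δ₀ * ρ) * ((Nd + Nd * Fintype.card Cp : ℝ) * v₁ + v₂)) *
        B6.c1 d δ₀ α *
        (1 - N' * (B₀ * Real.exp (δ₀ * ρ) * ((Nd + Nd * Fintype.card Cp : ℝ) * v₁ + (v₂ + (∑ l : Fin (k + 1), (2 * (∑ j ∈ Finset.range l, D j : ℕ) * θQ) * kk l)))) *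
          B6.c1 d δ₀ α)⁻¹ *
        Real.exp (-((1 - α) * δ₀ * g.dist a b))) := by
  have hzero : ∀ i (p : St × Cp), blk p ∉ S' i → hs i p.1 = 0 := fun i p hp => by
    by_contra hne
    exact hp (hS'Q i p hne)
  obtain ⟨hQ, hKQ, hlocQ, hrowQ, hcolQ⟩ := commData_towerLevelSum_of_bondBound (g := g) (R := R) (H := H) Ks Rm hRm k W a
    wb n D blk hnestTop hW hn hD ρ (fun b => by rw [hrefl b]; exact hρ) kk hk hs S' hθQ0 hθQ hzero
  have hκQ : 0 ≤ (∑ l : Fin (k + 1), (2 * (∑ j ∈ Finset.range l, D j : ℕ) * θQ) * kk l) :=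
    Finset.sum_nonneg fun l _ => mul_nonneg (by positivity) (hkk l)
  clear hcolQ
  exact thm37_entry4_of_342_lattice_of_387_sz blk blkY src tgt c Rm _ d Nd δ₀ α ρ B₀ v₁ v₂ _ N N' S S' hs θ θ₂ _ hRm hB₀ hδ₀ hρ hv₁ hv₂ hκQ hN hN' hαδ htri hrefl hdnn hlen h261 h263 hsmall hh hS hcnt hcnt' hθ0 hθ hθ₂0 hθ₂ hsupp hNs hNt hadj hV₁ hV₂ hKQ hlocQ hrowQ hsq h342_1 h342_2 h342_4 hQ hloc hinv

end

end Literature.MathematicalPhysics.QuantumFieldTheory.Balaban1983to89.B9Thm37GlueTowerEntries
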